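import Summits.CriticalPhenomena.PercolationContinuityZ3.Theorems.SahiMasterFamilyFInequalityThreeColouring
import Summits.CriticalPhenomena.PercolationContinuityZ3.Theorems.SahiMasterFamilyFInequalityMSTightMain

/-!
# (AMS) with three labels when one antipodal type class has at most one pair

Support file for the master-family `F`-inequality programme (`prim-master-conj` gen 29; `--supports stmt-CriticalPhenomena-4575`;
memo `run/shared/lean/prim/prim-l12/prim-master-conj/MS-EQUALITY.md` §2, POINTWISE §29.4 (L1)).  No definition, no `sorry`, standard
axioms.

Setting (file `…ThreeColouring`): `S` a complement-closed finite family of subsets of a finite type, `c` a labelling with at most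
three labels and `c xᶜ ≠ c x` on `S`, colour classes `A_i = {x ∈ S : c x = i}`; the three-label form of conjecture (AMS) is
`#S ≤ 2 · #(⋃_i A_i \\ A_i)` (`ams_card_three_iff`).  It is proved in the tree when the class graph is bipartite or a class is
dominant; the open case is the "triangle" (all three antipodal type classes `{i,j}` occur).

THEOREM (`card_le_two_mul_card_biUnion_diffs_of_card_filter_le_one`, new): **(AMS) holds whenever some ordered type class
`{x ∈ S : c x = a, c xᶜ = b}` (`a ≠ b`) has at most one element** — the first infinite family of triangle instances in the kernel
(POINTWISE §29.4 (L1); conjectured lemma (P1) there).  Corollary `card_le_two_mul_card_amsUnions_of_card_filter_le_one`: the same in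
the `amsUnions` form of `AMSWeighted`.

PROOF (memo §2).  Let `e` be the third label and `F = A_e` (here: the points whose label is neither `a` nor `b`; with ≤ 3 labels they
form one class).  Every antipodal pair has exactly one point in `F` except the pairs of type `{a,b}`, so `#S ≤ 2#F + 2#X` with
`X = {x : c x = a, c xᶜ = b}`.  If `X = ∅` Marica–Schönheim for `F` suffices.  If `X = {p}` and `F` is not tight, again done.  If `F`
is tight, the structure theorem of part IV (`exists_witness_of_card_diffs_eq_card`) provides `h ∈ F` such that
`h \ x, x \ h ∈ F \\ F ⟹ x ∈ F`.  If `c hᶜ = a` then `hᶜ, p ∈ A_a` and `p \ hᶜ = h \ pᶜ`, `hᶜ \ p = pᶜ \ h` are both in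
`A_a \\ A_a ⊆ ⋃ A_i \\ A_i`; they cannot both lie in `F \\ F` since `pᶜ ∉ F`.  If `c hᶜ = b`, symmetrically with `A_b ∋ hᶜ, pᶜ` and
`x = p`.  Either way `⋃ A_i \\ A_i` has an element outside `F \\ F ⊆ ⋃ A_i \\ A_i`, so `#⋃ ≥ #F + 1` and `#S ≤ 2#F + 2 ≤ 2#⋃`.

HONEST FRAMING: a special case of an OPEN conjecture of this programme, obtained from our characterisation of equality in
Marica–Schönheim; [this work].
-/

namespace Summit.CriticalPhenomena.PercolationContinuityZ3.Theorems

namespace TwistedAD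

open Finset
open scoped FinsetFamily Classical

variable {κ : Type*} [Fintype κ] [DecidableEq κ]

/-- Pigeonhole with three labels: if `a ≠ b`, `i ∉ {a,b}` and `j ≠ i`, then `j = a ∨ j = b`. [this work] -/
theorem eq_or_eq_of_card_le_three {L : Type*} [Fintype L] (hL : Fintype.card L ≤ 3)
    {a b i j : L} (hab : a ≠ b) (hia : i ≠ a) (hib : i ≠ b) (hji : j ≠ i) : j = a ∨ j = b := by
  by_contra hcon
  rw [not_or] at hcon
  have hcard : ({a, b, i, j} : Finset L).card = 4 := by
    rw [card_insert_of_notMem, card_insert_of_notMem, card_insert_of_notMem, card_singleton]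
    · simpa using hji.symm
    · simp only [mem_insert, mem_singleton, not_or]; exact ⟨hib.symm, fun h => hcon.2 h.symm⟩
    · simp only [mem_insert, mem_singleton, not_or]; exact ⟨hab, hia.symm, fun h => hcon.1 h.symm⟩
  have := card_le_univ ({a, b, i, j} : Finset L)
  rw [hcard] at this
  omega

/-- **(AMS-3) when an ordered type class has at most one point.**  Let `S` be complement-closed, `c` a labelling into at most three
labels with `c xᶜ ≠ c x` on `S`, and suppose `#{x ∈ S : c x = a ∧ c xᶜ = b} ≤ 1` for some labels `a ≠ b`.  Then
`#S ≤ 2 · #(⋃_i A_i \\ A_i)`. [this work] -/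
theorem card_le_two_mul_card_biUnion_diffs_of_card_filter_le_one {L : Type*} [Fintype L] (hL : Fintype.card L ≤ 3)
    (S : Finset (Finset κ)) (c : Finset κ → L) (hScl : ∀ x ∈ S, xᶜ ∈ S) (hc : ∀ x ∈ S, c xᶜ ≠ c x)
    {a b : L} (hab : a ≠ b) (hX : #(S.filter (fun x => c x = a ∧ c xᶜ = b)) ≤ 1) :
    S.card ≤ 2 * ((univ : Finset L).biUnion (fun i => (S.filter (fun x => c x = i)) \\ (S.filter (fun x => c x = i)))).card := by
  set X := S.filter (fun x => c x = a ∧ c xᶜ = b) with hXdef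
  set F := S.filter (fun x => c x ≠ a ∧ c x ≠ b) with hFdef
  set D := (univ : Finset L).biUnion (fun i => (S.filter (fun x => c x = i)) \\ (S.filter (fun x => c x = i))) with hDdef
  -- class differences lie in `D`
  have hclass : ∀ {x y : Finset κ}, x ∈ S → y ∈ S → c x = c y → x \ y ∈ D := by
    intro x y hx hy hxy
    rw [hDdef, mem_biUnion]
    exact ⟨c x, mem_univ _, mem_diffs.2 ⟨x, mem_filter.2 ⟨hx, rfl⟩, y, mem_filter.2 ⟨hy, hxy.symm⟩, rfl⟩⟩
  -- counting: `#S ≤ 2 #F + 2 #X`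
  have hcount : #S ≤ #F + #F + (#X + #X) := by
    have hsub : S ⊆ (F ∪ F.image compl) ∪ (X ∪ X.image compl) := by
      intro x hx
      simp only [mem_union, mem_image, hFdef, hXdef, mem_filter]
      by_cases hxa : c x = a
      · by_cases hxb : c xᶜ = b
        · exact Or.inr (Or.inl ⟨hx, hxa, hxb⟩)
        · refine Or.inl (Or.inr ⟨xᶜ, ⟨hScl x hx, ?_, hxb⟩, compl_compl x⟩)
          intro h; exact hc x hx (h.trans hxa.symm)
      · by_cases hxb : c x = b
        · by_cases hxca : c xᶜ = a
          · refine Or.inr (Or.inr ⟨xᶜ, ⟨hScl x hx, hxca, ?_⟩, compl_compl x⟩)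
            rw [compl_compl]; exact hxb
          · refine Or.inl (Or.inr ⟨xᶜ, ⟨hScl x hx, hxca, ?_⟩, compl_compl x⟩)
            intro h; exact hc x hx (h.trans hxb.symm)
        · exact Or.inl (Or.inl ⟨hx, hxa, hxb⟩)
    calc #S ≤ #((F ∪ F.image compl) ∪ (X ∪ X.image compl)) := card_le_card hsub
      _ ≤ #(F ∪ F.image compl) + #(X ∪ X.image compl) := card_union_le _ _
      _ ≤ (#F + #(F.image compl)) + (#X + #(X.image compl)) := Nat.add_le_add (card_union_le _ _) (card_union_le _ _)
      _ ≤ #F + #F + (#X + #X) := Nat.add_le_add (Nat.add_le_add_left card_image_le _) (Nat.add_le_add_left card_image_le _)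
  -- `F` is one colour class, so `F \\ F ⊆ D`
  have hFS : ∀ x ∈ F, x ∈ S := fun x hx => (mem_filter.1 hx).1
  have hFlab : ∀ x ∈ F, ∀ y ∈ F, c x = c y := by
    intro x hx y hy
    obtain ⟨-, hxa, hxb⟩ := mem_filter.1 hx
    obtain ⟨-, hya, hyb⟩ := mem_filter.1 hy
    by_contra hne
    rcases eq_or_eq_of_card_le_three hL hab hxa hxb (Ne.symm hne) with h | h
    · exact hya h
    · exact hyb h
  have hFD : F \\ F ⊆ D := by
    intro d hd
    obtain ⟨x, hx, y, hy, rfl⟩ := mem_diffs.1 hd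
    exact hclass (hFS x hx) (hFS y hy) (hFlab x hx y hy)
  have hMS : #F ≤ #(F \\ F) := F.card_le_card_diffs
  -- Case `X = ∅`
  rcases Nat.lt_or_ge #X 1 with hX0 | hX1
  · have : #X = 0 := by omega
    have h1 : #S ≤ 2 * #F := by omega
    exact h1.trans (Nat.mul_le_mul_left 2 (hMS.trans (card_le_card hFD)))
  -- Case `X = {p}`
  have hX1' : #X = 1 := le_antisymm hX hX1
  obtain ⟨p, hXp⟩ := card_eq_one.1 hX1'
  have hp : p ∈ X := by rw [hXp]; exact mem_singleton_self p
  obtain ⟨hpS, hpa, hpb⟩ := mem_filter.1 hp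
  have hpcS : pᶜ ∈ S := hScl p hpS
  have hS2 : #S ≤ 2 * #F + 2 := by omega
  -- `D` is nonempty: `∅ = p \ p ∈ D`
  have hDne : 1 ≤ #D := card_pos.2 ⟨p \ p, hclass hpS hpS rfl⟩
  rcases F.eq_empty_or_nonempty with hF0 | hFne
  · rw [hF0, card_empty] at hS2; omega
  -- if `F` is not tight we are done
  by_cases htight : #(F \\ F) = #F
  swap
  · have : #F + 1 ≤ #(F \\ F) := by omega
    calc #S ≤ 2 * #F + 2 := hS2
      _ ≤ 2 * #(F \\ F) := by omega
      _ ≤ 2 * #D := Nat.mul_le_mul_left 2 (card_le_card hFD)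
  -- `F` tight: the witness `h`
  obtain ⟨h, hhF, hwit⟩ := exists_witness_of_card_diffs_eq_card F htight hFne
  have hhS : h ∈ S := hFS h hhF
  obtain ⟨-, hha, hhb⟩ := mem_filter.1 hhF
  have hpF : p ∉ F := fun h' => (mem_filter.1 h').2.1 hpa
  have hpcF : pᶜ ∉ F := fun h' => (mem_filter.1 h').2.2 hpb
  -- some class difference outside `F \\ F`
  have hnew : ∃ d ∈ D, d ∉ F \\ F := by
    rcases eq_or_eq_of_card_le_three hL hab hha hhb (hc h hhS) with hca | hcb
    · -- `c hᶜ = a`: use `x = pᶜ` and the class `A_a ∋ hᶜ, p`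
      have h1 : h \ pᶜ ∈ D := by
        have : h \ pᶜ = p \ hᶜ := by rw [sdiff_compl, sdiff_compl, inf_comm]
        rw [this]; exact hclass hpS (hScl h hhS) (hpa.trans hca.symm)
      have h2 : pᶜ \ h ∈ D := by
        have : pᶜ \ h = hᶜ \ p := by rw [← compl_sdiff_compl, compl_compl]
        rw [this]; exact hclass (hScl h hhS) hpS (hca.trans hpa.symm)
      by_cases hd1 : h \ pᶜ ∈ F \\ F
      · exact ⟨pᶜ \ h, h2, fun hd2 => hpcF (hwit pᶜ hd1 hd2)⟩
      · exact ⟨h \ pᶜ, h1, hd1⟩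
    · -- `c hᶜ = b`: use `x = p` and the class `A_b ∋ hᶜ, pᶜ`
      have h1 : h \ p ∈ D := by
        have : h \ p = pᶜ \ hᶜ := compl_sdiff_compl.symm
        rw [this]; exact hclass hpcS (hScl h hhS) (hpb.trans hcb.symm)
      have h2 : p \ h ∈ D := by
        have : p \ h = hᶜ \ pᶜ := compl_sdiff_compl.symm
        rw [this]; exact hclass (hScl h hhS) hpcS (hcb.trans hpb.symm)
      by_cases hd1 : h \ p ∈ F \\ F
      · exact ⟨p \ h, h2, fun hd2 => hpF (hwit p hd1 hd2)⟩
      · exact ⟨h \ p, h1, hd1⟩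
  obtain ⟨d, hdD, hdF⟩ := hnew
  have hcardD : #F + 1 ≤ #D := by
    have : #(insert d (F \\ F)) ≤ #D := card_le_card (insert_subset hdD hFD)
    rw [card_insert_of_notMem hdF, htight] at this
    exact this
  calc #S ≤ 2 * #F + 2 := hS2
    _ ≤ 2 * #D := by omega

/-- The same in the `amsUnions` form of conjecture (AMS) (`AMSWeighted` with unit weight, relation `c x = c z`): with at most three
labels and an ordered type class of size ≤ 1, `#S ≤ 2 · #J(S, (c · = c ·))`. [this work] -/
theorem card_le_two_mul_card_amsUnions_of_card_filter_le_one {L : Type*} [Fintype L] (hL : Fintype.card L ≤ 3)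
    (S : Finset (Finset κ)) (c : Finset κ → L) (hScl : ∀ x ∈ S, xᶜ ∈ S) (hc : ∀ x ∈ S, c xᶜ ≠ c x)
    {a b : L} (hab : a ≠ b) (hX : #(S.filter (fun x => c x = a ∧ c xᶜ = b)) ≤ 1) :
    S.card ≤ 2 * (amsUnions S (fun x y => c x = c y)).card := by
  rw [ams_card_three_iff hL S c hScl hc]
  exact card_le_two_mul_card_biUnion_diffs_of_card_filter_le_one hL S c hScl hc hab hX

end TwistedAD

end Summit.CriticalPhenomena.PercolationContinuityZ3.Theorems
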